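import Summits.NavierStokesRegularity.NavierStokesRegularity.Theorems.GaldiLiouvilleGateRecordZoomAncientStubLocalZoomLimit
import HarnessLib

/-!
# Route `GaldiLiouvilleGate`, crux `RecordZoomAncient` (stmt-NavierStokesRegularity-0894),
  line `registered` (birth skeleton, reshape r8) — stub `stub_localZoomLimitOseen`

**Statement.** For a classical solution `(u, p)` of the unforced Navier–Stokes system
(viscosity `ν`) on `ℝ³ × [0, T)`, Leray–Hopf from `u 0`: base times `tc n ∈ (0, T)`, centres
`xc n`, velocity levels `M n > 0` with `‖u(t, x)‖ ≤ M n` on `[0, tc n] × ℝ³`, `tc n (M n)² → ∞`,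
and the LOCAL enstrophy bounds — for all `R, S > 0`, eventually in `n`, for
`t ∈ [tc n − S ν/(M n)², tc n]`, `∫_{B(xc n, R ν/M n)} |∇u(t)|² ≤ D ν M n`. Then the
velocity-normalised zooms `z n (s, y) = (M n)⁻¹ u(tc n + ν s/(M n)², xc n + (ν/M n) y)` converge
along a subsequence — pointwise and locally uniformly on every negative slice — to a field `v`
continuous on `(−∞, 0) × ℝ³`, bounded by `1`, with weakly divergence-free slices, satisfying the
Oseen identity `v(t) = e^{(t−s)Δ}v(s) − B¹_s(v, v)(t)` for all `s < t < 0`, smooth on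
`(−∞, 0) × ℝ³`; and the zooms inherit the local enstrophy bound in their own units: for
`R, S > 0`, eventually in `n`, for `s ∈ [−S, 0]`, `∫_{B(0, R)} |∇z n(s)|² ≤ D`.

**Proof (KNSS 2009, Lemma 6.1; the tree's `stub_localZoomLimit` without its `L⁶` steps, keeping
all outputs of `KNSS2009_lemma61_oseenMild`).** Scales `α = 1/M`, `γ = ν/M`, `β = α γ = ν/M²`,
viscosity `α ν/γ = 1`: each zoom is a classical solution (`IsClassicalNSSolutionOn.stRescale`) on
the window `(A n, b n)`, `A n = −tc n (M n)²/ν → −∞`, `b n > 0`, bounded by `(M n)⁻¹ M n = 1` on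
`(A n, 0]`, with `L²`-bounded slices (Leray–Hopf energy bound and change of variables), hence
Oseen-mild there (`mild_of_bounded_of_eLpNorm_two_le_of_lt`); `KNSS2009_lemma61_oseenMild`
extracts the subsequence and the ancient Oseen-mild limit (continuity on the open slab, the bound
`1`, weakly divergence-free slices, the Oseen identity, pointwise and slice-wise locally uniform
convergence), jointly smooth by `HardyAncientLimit.isSmoothSpaceTimeOn_of_oseen` (KNSS 2009,
Prop. 4.1). The inherited local enstrophy bound is the change of variables `y ↦ xc n + γ y` on
balls (`∇z = α γ (∇u) ∘ Φ`, `(α γ)² γ⁻³ ν M = 1`; the template's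
`setLIntegral_ball_frobeniusNormSq_fderiv_zoom`), valid once `S ν/(M n)² ≤ tc n` (eventually).

Sources: G. Koch, N. Nadirashvili, G. Seregin, V. Šverák, Acta Math. 203 (2009), Lemma 6.1,
Prop. 4.1, §6 (6.1)–(6.3).
-/

noncomputable section

open Set MeasureTheory Filter Topology Function TopologicalSpace Literature.Analysis.FluidPDE
open scoped ENNReal NNReal InnerProductSpace RealInnerProductSpace

namespace Summit.NavierStokesRegularity.NavierStokesRegularity.Theorems.RecordZoomAncient.Birth

-- the problem-side namespace `Summit.NavierStokesRegularity.NavierStokesRegularity.…` (summit =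
-- problem for this single-problem summit) duplicates `NavierStokesRegularity` by design
set_option linter.dupNamespace false

/-- **R2 — `stub_localZoomLimitOseen` (KNSS 2009, Lemma 6.1-type compactness of the
velocity-normalised zooms under local enstrophy bounds, exporting the Oseen-mild data of the
limit; statement and proof in the module docstring).** -/
theorem stub_localZoomLimitOseen :
    ∀ (ν T : ℝ), 0 < ν → 0 < T →
      ∀ (u : ℝ → EuclideanSpace ℝ (Fin 3) → EuclideanSpace ℝ (Fin 3)) (p : ℝ → EuclideanSpace ℝ (Fin 3) → ℝ),
        IsClassicalNSSolutionOn (Set.Ico 0 T) ν 0 u p → IsLerayHopfOn T ν 0 (u 0) u →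
        ∀ (tc : ℕ → ℝ) (xc : ℕ → EuclideanSpace ℝ (Fin 3)) (M : ℕ → ℝ) (D : ℝ),
          (∀ n, 0 < tc n ∧ tc n < T) → (∀ n, 0 < M n) →
          (∀ n, ∀ t ∈ Set.Icc 0 (tc n), ∀ x, ‖u t x‖ ≤ M n) →
          Tendsto (fun n => tc n * M n ^ 2) atTop atTop →
          (∀ R S : ℝ, 0 < R → 0 < S → ∀ᶠ n in atTop, ∀ t ∈ Set.Icc 0 (tc n), tc n - S * (ν / M n ^ 2) ≤ t →
            (∫⁻ y in Metric.ball (xc n) (R * (ν / M n)), ENNReal.ofReal (frobeniusNormSq (fderiv ℝ (u t) y))) ≤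
              ENNReal.ofReal (D * (ν * M n))) →
          ∀ (z : ℕ → ℝ → EuclideanSpace ℝ (Fin 3) → EuclideanSpace ℝ (Fin 3)),
            (∀ n s y, z n s y = (M n)⁻¹ • u (tc n + ν / M n ^ 2 * s) (xc n + (ν / M n) • y)) →
            ∃ (φ : ℕ → ℕ) (v : ℝ → EuclideanSpace ℝ (Fin 3) → EuclideanSpace ℝ (Fin 3)), StrictMono φ ∧
              (∀ s < 0, ∀ y, Tendsto (fun n => z (φ n) s y) atTop (𝓝 (v s y))) ∧
              (∀ s < 0, TendstoLocallyUniformly (fun n => z (φ n) s) (v s) atTop) ∧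
              ContinuousOn (Function.uncurry v) (Set.Iio 0 ×ˢ Set.univ) ∧
              (∀ s < 0, ∀ y, ‖v s y‖ ≤ 1) ∧
              (∀ s < 0, IsWeaklyDivFree (v s)) ∧
              (∀ s t : ℝ, s < t → t < 0 → ∀ y,
                v t y = Literature.Analysis.UnboundedOperators.heatExtension (v s) (t - s) y -
                  oseenDuhamel 1 s v v t y) ∧
              ContDiffOn ℝ (⊤ : ℕ∞) (Function.uncurry v) (Set.Iio 0 ×ˢ Set.univ) ∧
              (∀ R S : ℝ, 0 < R → 0 < S → ∀ᶠ n in atTop, ∀ s ∈ Set.Icc (-S) 0,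
                (∫⁻ y in Metric.ball 0 R, ENNReal.ofReal (frobeniusNormSq (fderiv ℝ (z n s) y))) ≤
                  ENNReal.ofReal D) := by
  intro ν T hν _hT u p hcl hLH tc xc M D htc hM hbd hprod hE z hz
  -- ### scales `α = 1/M`, `γ = ν/M`, `β = α γ = ν/M²` (viscosity `α ν/γ = 1`), windows
  have hαpos : ∀ n, 0 < (M n)⁻¹ := fun n => inv_pos.2 (hM n)
  have hγpos : ∀ n, 0 < ν / M n := fun n => div_pos hν (hM n)
  have hβpos : ∀ n, 0 < ν / M n ^ 2 := fun n => div_pos hν (pow_pos (hM n) 2)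
  obtain ⟨A, hA⟩ : ∃ A : ℕ → ℝ, ∀ n, A n = -(tc n * M n ^ 2 / ν) := ⟨_, fun n => rfl⟩
  obtain ⟨b, hb⟩ : ∃ b : ℕ → ℝ, ∀ n, b n = (T - tc n) * M n ^ 2 / ν := ⟨_, fun n => rfl⟩
  have halg : ∀ n s, ν / M n ^ 2 = (M n)⁻¹ * (ν / M n) ∧ (M n)⁻¹ * ν / (ν / M n) = 1 ∧
      (M n)⁻¹ * M n = 1 ∧
      tc n + ν / M n ^ 2 * s = ν / M n ^ 2 * (s - A n) ∧
      T - (tc n + ν / M n ^ 2 * s) = ν / M n ^ 2 * (b n - s) ∧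
      ((M n)⁻¹ * (ν / M n)) ^ 2 * ((ν / M n) ^ 3)⁻¹ * (ν * M n) = 1 := by
    intro n s
    have hMn : M n ≠ 0 := (hM n).ne'
    have hν0 : ν ≠ 0 := hν.ne'
    rw [hA n, hb n]
    refine ⟨?_, ?_, ?_, ?_, ?_, ?_⟩ <;> field_simp <;> ring
  have hbpos : ∀ n, 0 < b n := fun n =>
    (hb n).symm ▸ div_pos (mul_pos (sub_pos.2 (htc n).2) (pow_pos (hM n) 2)) hν
  have hs_lt_b : ∀ n s, s ≤ 0 → s < b n := fun n s hs => lt_of_le_of_lt hs (hbpos n)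
  -- original times of rescaled times
  have hmem_Ico : ∀ n s, A n < s → s < b n → tc n + ν / M n ^ 2 * s ∈ Ico 0 T := by
    intro n s h1 h2
    obtain ⟨-, -, -, hoA, hob, -⟩ := halg n s
    have h3 : 0 < ν / M n ^ 2 * (s - A n) := mul_pos (hβpos n) (by linarith)
    have h4 : 0 < ν / M n ^ 2 * (b n - s) := mul_pos (hβpos n) (by linarith)
    constructor <;> linarith
  have hmem_Icc0 : ∀ n s, A n < s → s ≤ 0 → tc n + ν / M n ^ 2 * s ∈ Icc 0 (tc n) := by
    intro n s h1 h2
    obtain ⟨-, -, -, hoA, -⟩ := halg n s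
    have h3 : 0 ≤ ν / M n ^ 2 * (s - A n) := mul_nonneg (hβpos n).le (by linarith)
    have h4 : ν / M n ^ 2 * s ≤ 0 := mul_nonpos_of_nonneg_of_nonpos (hβpos n).le h2
    constructor <;> linarith
  -- ### the zooms are classical solutions with viscosity `1` on `(A n, b n)`
  have hzslice : ∀ n s, z n s =
      (M n)⁻¹ • fun y => u (tc n + ν / M n ^ 2 * s) (xc n + (ν / M n) • y) :=
    fun n s => funext fun y => hz n s y
  have hzeq : ∀ n, z n = (M n)⁻¹ • stPull (ν / M n ^ 2) (ν / M n) (tc n) (xc n) u :=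
    fun n => funext fun s => funext fun y => by rw [hz n s y]; rfl
  have hclz : ∀ n, IsClassicalNSSolutionOn (Ioo (A n) (b n)) 1 0 (z n)
      ((M n)⁻¹ ^ 2 • stPull (ν / M n ^ 2) (ν / M n) (tc n) (xc n) p) := by
    intro n
    obtain ⟨hβeq, hvisc, -⟩ := halg n 0
    have h := hcl.stRescale (hαpos n) (hγpos n) hβeq (tc n) (xc n)
    rw [smul_stPull_zero, hvisc, ← hzeq n] at h
    exact h.mono (fun s hs => hmem_Ico n s hs.1 hs.2) (uniqueDiffOn_Ioo _ _)
  have hC1z : ∀ n s, s ∈ Ioo (A n) (b n) → ContDiff ℝ 1 (z n s) := fun n s hs =>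
    ((hclz n).contDiff_velocity hs).of_le (by norm_cast)
  -- ### the inputs of KNSS 2009, Lemma 6.1
  have hAlim : Tendsto A atTop atBot := by
    refine (tendsto_neg_atTop_atBot.comp (hprod.atTop_div_const hν)).congr fun n => ?_
    rw [hA n, Function.comp_apply]
  have hcontz : ∀ n, ContinuousOn (uncurry (z n)) (Ioo (A n) 0 ×ˢ univ) := fun n =>
    (hclz n).smooth_velocity.continuousOn.mono
      (prod_mono (Ioo_subset_Ioo_right (hbpos n).le) subset_rfl)
  have hdivz : ∀ n, ∀ s ∈ Ioo (A n) 0, IsWeaklyDivFree (z n s) := fun n s hs =>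
    VectorCalculus.IsDivFree.isWeaklyDivFree_holds
      ((hclz n).divFree s ⟨hs.1, hs_lt_b n s hs.2.le⟩) (hC1z n s ⟨hs.1, hs_lt_b n s hs.2.le⟩)
  have hzb : ∀ n s, A n < s → s ≤ 0 → ∀ y, ‖z n s y‖ ≤ 1 := by
    intro n s h1 h2 y
    obtain ⟨-, -, h1eq, -⟩ := halg n s
    rw [hz n s y, norm_smul, Real.norm_of_nonneg (hαpos n).le, ← h1eq]
    exact mul_le_mul_of_nonneg_left (hbd n _ (hmem_Icc0 n s h1 h2) _) (hαpos n).le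
  -- `L²` bounds of the zoom slices (Leray–Hopf energy bound and change of variables)
  obtain ⟨E2, hE2top, hE2⟩ : ∃ E2 : ℝ≥0∞, E2 ≠ ∞ ∧ ∀ t ∈ Icc 0 T, eLpNorm (u t) 2 volume ≤ E2 := by
    refine ⟨ENNReal.ofReal (Real.sqrt (2 * VectorCalculus.kineticEnergy (u 0))),
      ENNReal.ofReal_ne_top, fun t ht => (ENNReal.pow_le_pow_left_iff two_ne_zero).1 ?_⟩
    rw [eLpNorm_two_sq_eq_lintegral, ← ENNReal.ofReal_pow (Real.sqrt_nonneg _),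
      Real.sq_sqrt (mul_nonneg zero_le_two (kineticEnergy_nonneg _))]
    exact hLH.lintegral_enorm_sq_le hν.le ht
  have hKz : ∀ n, ∃ K : ℝ≥0∞, K ≠ ∞ ∧ ∀ s, A n < s → s ≤ 0 → eLpNorm (z n s) 2 volume ≤ K := by
    intro n
    refine ⟨‖(M n)⁻¹‖ₑ *
      (ENNReal.ofReal ((ν / M n) ^ Module.finrank ℝ (EuclideanSpace ℝ (Fin 3)))⁻¹ ^
        (1 / (2 : ℝ≥0∞)).toReal * E2), ?_, fun s h1 h2 => ?_⟩
    · exact ENNReal.mul_ne_top enorm_ne_top (ENNReal.mul_ne_top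
        (ENNReal.rpow_ne_top_of_nonneg ENNReal.toReal_nonneg ENNReal.ofReal_ne_top) hE2top)
    · rw [hzslice n s, eLpNorm_const_smul, eLpNorm_comp_space_affine (hγpos n) (xc n) _ 2]
      gcongr
      exact hE2 _ ⟨(hmem_Icc0 n s h1 h2).1, (hmem_Icc0 n s h1 h2).2.trans (htc n).2.le⟩
  -- the Oseen identity of each zoom between negative times of its bounded region
  have hmildz : ∀ n, ∀ s t : ℝ, A n < s → s < t → t < 0 → ∀ x,
      z n t x = Literature.Analysis.UnboundedOperators.heatExtension (z n s) (t - s) x -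
        oseenDuhamel 1 s (z n) (z n) t x := by
    intro n s t h1 h2 h3 x
    obtain ⟨K, hKtop, hK⟩ := hKz n
    exact mild_of_bounded_of_eLpNorm_two_le_of_lt (hclz n) (h1.trans (h2.trans h3)) (hbpos n)
      (fun τ hτ y => hzb n τ hτ.1 hτ.2 y) hKtop (fun τ hτ => hK τ hτ.1 hτ.2) h1 h2 h3 x
  -- ### the inherited local bound: `[-S, 0]` zooms into `[tc n - S β, tc n] ⊆ [0, tc n]`
  have hwin : ∀ S : ℝ, 0 < S → ∀ᶠ n in atTop, ∀ s ∈ Icc (-S) 0,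
      tc n + ν / M n ^ 2 * s ∈ Icc 0 (tc n) ∧
        tc n - S * (ν / M n ^ 2) ≤ tc n + ν / M n ^ 2 * s := by
    intro S hS
    filter_upwards [hprod.eventually_ge_atTop (S * ν)] with n hn s hs
    have h1 : S * (ν / M n ^ 2) ≤ tc n := by
      rw [← mul_div_assoc, div_le_iff₀ (pow_pos (hM n) 2)]
      exact hn
    have h2 : ν / M n ^ 2 * -S ≤ ν / M n ^ 2 * s := mul_le_mul_of_nonneg_left hs.1 (hβpos n).le
    have h3 : ν / M n ^ 2 * s ≤ 0 := mul_nonpos_of_nonneg_of_nonpos (hβpos n).le hs.2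
    exact ⟨⟨by linarith, by linarith⟩, by linarith⟩
  have hlocE : ∀ R S : ℝ, 0 < R → 0 < S → ∀ᶠ n in atTop, ∀ s ∈ Icc (-S) 0,
      (∫⁻ y in Metric.ball 0 R, ENNReal.ofReal (frobeniusNormSq (fderiv ℝ (z n s) y))) ≤
        ENNReal.ofReal D := by
    intro R S hR hS
    filter_upwards [hE R S hR hS, hwin S hS] with n hn hn' s hs
    obtain ⟨ht, hlow⟩ := hn' s hs
    have hdiff : Differentiable ℝ (u (tc n + ν / M n ^ 2 * s)) :=
      (hcl.contDiff_velocity ⟨ht.1, ht.2.trans_lt (htc n).2⟩).differentiable (by simp)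
    obtain ⟨-, -, -, -, -, hid⟩ := halg n s
    rw [hzslice n s, setLIntegral_ball_frobeniusNormSq_fderiv_zoom (hγpos n) _ (xc n) hdiff R,
      finrank_euclideanSpace_fin]
    calc _ ≤ ENNReal.ofReal (((M n)⁻¹ * (ν / M n)) ^ 2) * ENNReal.ofReal ((ν / M n) ^ 3)⁻¹ *
          ENNReal.ofReal (D * (ν * M n)) := by
          gcongr
          exact hn _ ht hlow
      _ = ENNReal.ofReal D := by
        rw [mul_comm D, ENNReal.ofReal_mul (mul_pos hν (hM n)).le, ← mul_assoc,
          ← ENNReal.ofReal_mul (sq_nonneg _),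
          ← ENNReal.ofReal_mul (mul_nonneg (sq_nonneg _)
            (inv_nonneg.2 (pow_nonneg (hγpos n).le _))),
          hid, ENNReal.ofReal_one, one_mul]
  -- ### KNSS 2009, Lemma 6.1: the subsequence and the ancient Oseen-mild limit
  obtain ⟨φ, W, hφ, hWc, hWdiv, hWb, hWmild, -, hpt, hloc⟩ :=
    KNSS2009_lemma61_oseenMild hAlim hcontz hdivz hmildz fun n τ hτ y => hzb n τ hτ.1 hτ.2.le y
  -- smoothness of the limit (KNSS 2009, Prop. 4.1)
  have hsm : IsSmoothSpaceTimeOn (Iio 0) W :=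
    HardyAncientLimit.isSmoothSpaceTimeOn_of_oseen hWc zero_le_one hWb hWmild
  exact ⟨φ, W, hφ, hpt, hloc, hWc, hWb, hWdiv, hWmild, hsm, hlocE⟩

end Summit.NavierStokesRegularity.NavierStokesRegularity.Theorems.RecordZoomAncient.Birth

end
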